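import Literature.NumberTheory.GaloisRepresentations.LocalField
import Literature.NumberTheory.GaloisRepresentations.LocalFieldModulus
import Literature.NumberTheory.GaloisRepresentations.WeakTriangleInequality
import Mathlib.NumberTheory.Ostrowski
import Mathlib.Analysis.Normed.Algebra.GelfandMazur
import Mathlib.Analysis.Normed.Field.Ultra
import Mathlib.Analysis.Normed.Field.WithAbs
import Mathlib.Analysis.Normed.Field.ProperSpace
import Mathlib.Topology.Algebra.Module.FiniteDimension
import Mathlib.Topology.Instances.Rat
import HarnessLib

/-!
# Proof of Weil's classification of local fields (`LocalField.lean`, Weil 1967 Ch. I §3–§4)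

D-0014 keeps `Literature/` sorry-free by stating cited results as named facts `def X : Prop`.
This sibling file of `Literature.NumberTheory.GaloisRepresentations.LocalField` proves the named
fact `Literature.NumberTheory.GaloisRepresentations.IsLocalField.isNonarchimedean_or_archimedean` (Weil, *Basic Number Theory*, 1967,
Ch. I §3 Theorem 5 and §4 Theorem 8; also the alias `nonarchimedean_or_archimedean`) as
`theorem isNonarchimedean_or_archimedean_holds`, following Weil's proof via the module `mod_F`
of `Literature.NumberTheory.GaloisRepresentations.LocalFieldModulus` (Weil, Ch. I §2). The file
contains theorems only (no new definitions).

## The argument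

Let `F` be a local field in Weil's sense (`Literature.IsLocalField F`) and `mod_F` its module; by Weil,
Ch. I §2, Thm. 4, `mod_F (x + y) ≤ A · max (mod_F x, mod_F y)`, so a power `mod_F ^ t` is an
absolute value (Artin's criterion, `WeakTriangleInequality.lean`;
`exists_absoluteValue_eq_modulus_rpow`). Weil's dichotomy (Ch. I §3, Lemma 4 and Theorem 5) is
on whether `mod_F` is bounded on the prime ring:

* if `mod_F (n · 1) ≤ 1` for all `n`, then `mod_F` is ultrametric (Weil, Ch. I §3, Lemma 4; here via
  Mathlib's `IsUltrametricDist.isUltrametricDist_of_forall_norm_natCast_le_one`), hence a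
  valuation; its valuative relation makes `F` a non-archimedean local field in Mathlib's sense,
  because the balls of `mod_F` form a basis of neighbourhoods of `0` (Weil, Ch. I §2, Cor. 1 of
  Prop. 2) and `mod_F` is non-trivial (`F` is not discrete);
* otherwise `F` has characteristic `0` (Weil, Ch. I §3, Thm. 5), `mod_F` restricted to `ℚ` is a power
  of the ordinary absolute value (Ostrowski; Mathlib's `Rat.AbsoluteValue.equiv_real_of_unbounded`),
  so a power `N = mod_F ^ s` is an absolute value on `F` inducing `|·|` on `ℚ` (Artin's criterion
  again) and the topology of `F` (Weil, Ch. I §2, Cor. 1). As `F` is locally compact it is complete,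
  so `ℚ ⊆ F` extends to an isometric ring embedding `ℝ → F` (the closure of `ℚ` is `ℚ_∞ = ℝ`, Weil,
  Ch. I §3, proof of Thm. 5), making `F` a normed `ℝ`-algebra with multiplicative norm; by the
  Gelfand–Mazur–Ostrowski theorem (Mathlib's `NormedAlgebra.Real.nonempty_algEquiv_or`; Weil
  calls this step "well known", Ch. I §3, after Def. 2, with a proof in Ch. IX-4) `F ≃ₐ[ℝ] ℝ` or
  `F ≃ₐ[ℝ] ℂ`, and such an isomorphism is a homeomorphism (finite-dimensional normed spaces).

## References

* A. Weil, *Basic Number Theory*, Grundlehren 144, Springer 1967, Ch. I §2 (Prop. 1, 2, Cor. 1,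
  Thm. 4), §3 (Lemma 4, Thm. 5, Def. 2), §4 (Thm. 6, Thm. 8). [WeilBNT1967]
* J. W. S. Cassels, *Global fields*, Ch. II of Cassels–Fröhlich, *Algebraic Number Theory*, 1967,
  §1 (Artin's constant `C`, footnote). [CasselsFrohlichANT1967]
-/

open scoped NNReal Topology
open Filter Set

namespace Literature.NumberTheory.GaloisRepresentations

namespace IsLocalField

variable {F : Type*} [Field F] [TopologicalSpace F] [IsLocalField F]

/-! ### A power of the module is an absolute value -/

variable (F) in
/-- Some power `mod_F ^ t` (`t > 0`) of the module of a local field is an absolute value: by Weil,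
Ch. I §2, Thm. 4, `mod_F (x + y) ≤ A · max (mod_F x, mod_F y)`; choosing `t` with `A ^ t ≤ 2`,
`mod_F ^ t` satisfies Artin's inequality with constant `2`, hence the triangle inequality
(Cassels–Fröhlich, Ch. II §1, footnote). [cite: WeilBNT1967, Ch. I §2, Thm. 4] -/
theorem exists_absoluteValue_eq_modulus_rpow :
    ∃ (v : AbsoluteValue F ℝ) (t : ℝ), 0 < t ∧ ∀ x, v x = (modulus F x : ℝ) ^ t := by
  obtain ⟨A, -, hA⟩ := exists_modulus_add_le_mul_max (F := F) IsLocalField.not_discrete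
  obtain ⟨t, ht, hAt⟩ := exists_rpow_le_two (A : ℝ)
  have h2 : ∀ x y : F, nnrealRPow (modulus F) ht (x + y) ≤
      2 * max (nnrealRPow (modulus F) ht x) (nnrealRPow (modulus F) ht y) := fun x y =>
    (nnrealRPow_add_le (modulus F) ht hA x y).trans
      (mul_le_mul_of_nonneg_right hAt (le_max_of_le_left (nnrealRPow_nonneg _ _ _)))
  exact ⟨AbsoluteValue.ofMapAddLeTwoMulMax (nnrealRPow (modulus F) ht) (nnrealRPow_nonneg _ _)
    (fun x hx => (map_eq_zero (modulus F)).mp ((nnrealRPow_eq_zero_iff _ _ x).mp hx)) h2,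
    t, ht, fun x => rfl⟩

/-! ### The topology of `F` is the topology of any absolute value `mod_F ^ s` -/

section Topology

variable {v : AbsoluteValue F ℝ} {s : ℝ}

/-- If `v = mod_F ^ s` (`s > 0`), the identity `F → WithAbs v` is continuous: the `v`-balls around
`0` are open for the topology of `F` since `mod_F` is continuous (Weil, Ch. I §2, Prop. 1).
[cite: WeilBNT1967, Ch. I §2, Prop. 1] -/
theorem continuous_withAbsEquiv_symm (hs : 0 < s) (hv : ∀ x, v x = (modulus F x : ℝ) ^ s) :
    Continuous (WithAbs.equiv v).symm := by
  apply continuous_of_continuousAt_zero (WithAbs.equiv v).symm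
  rw [ContinuousAt, map_zero, Metric.nhds_basis_ball.tendsto_right_iff]
  intro ε hε
  have hopen : IsOpen {x : F | (modulus F x : ℝ) ^ s < ε} :=
    isOpen_lt ((Real.continuous_rpow_const hs.le).comp
      (NNReal.continuous_coe.comp (continuous_modulus IsLocalField.not_discrete))) continuous_const
  filter_upwards [hopen.mem_nhds (show (0 : F) ∈ {x : F | (modulus F x : ℝ) ^ s < ε} by
    simpa [Real.zero_rpow hs.ne'] using hε)] with x hx
  simpa [Metric.mem_ball, dist_zero_right, WithAbs.norm_eq_apply_ofAbs, hv] using hx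

/-- If `v = mod_F ^ s` (`s > 0`), the identity `WithAbs v → F` is continuous: the balls of `mod_F`
form a basis of neighbourhoods of `0` in `F` (Weil, Ch. I §2, Cor. 1 of Prop. 2).
[cite: WeilBNT1967, Ch. I §2, Cor. 1 of Prop. 2] -/
theorem continuous_withAbsEquiv (hs : 0 < s) (hv : ∀ x, v x = (modulus F x : ℝ) ^ s) :
    Continuous (WithAbs.equiv v) := by
  apply continuous_of_continuousAt_zero (WithAbs.equiv v)
  rw [ContinuousAt, map_zero]
  intro U hU
  obtain ⟨ε, hε, hsub⟩ :=
    (hasBasis_nhds_zero_modulus (F := F) IsLocalField.not_discrete).mem_iff.mp hU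
  rw [Filter.mem_map]
  apply mem_of_superset (Metric.ball_mem_nhds (0 : WithAbs v)
    (Real.rpow_pos_of_pos (by exact_mod_cast hε) s))
  intro y hy
  apply hsub
  simp only [Metric.mem_ball, dist_zero_right, WithAbs.norm_eq_apply_ofAbs, hv] at hy
  have : (modulus F (WithAbs.equiv v y) : ℝ) < ε := by
    rw [← Real.rpow_lt_rpow_iff (NNReal.coe_nonneg _) (NNReal.coe_nonneg ε) hs]
    exact hy
  exact_mod_cast this

/-- If `v = mod_F ^ s` (`s > 0`), the identity `WithAbs v → F` is a homeomorphism: the topology of a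
local field is the one defined by (any power of) its module (Weil, Ch. I §2, Cor. 1 of Prop. 2).
[cite: WeilBNT1967, Ch. I §2, Cor. 1 of Prop. 2] -/
theorem isHomeomorph_withAbsEquiv (hs : 0 < s) (hv : ∀ x, v x = (modulus F x : ℝ) ^ s) :
    IsHomeomorph (WithAbs.equiv v) :=
  (isHomeomorph_iff_exists_inverse).mpr ⟨continuous_withAbsEquiv hs hv, (WithAbs.equiv v).symm,
    (WithAbs.equiv v).symm_apply_apply, (WithAbs.equiv v).apply_symm_apply,
    continuous_withAbsEquiv_symm hs hv⟩

/-- `WithAbs v` is locally compact for `v = mod_F ^ s` (it is homeomorphic to `F`). [folklore] -/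
theorem locallyCompactSpace_withAbs (hs : 0 < s) (hv : ∀ x, v x = (modulus F x : ℝ) ^ s) :
    LocallyCompactSpace (WithAbs v) :=
  (isHomeomorph_withAbsEquiv hs hv).isClosedEmbedding.locallyCompactSpace

end Topology

/-! ### The non-archimedean case (Weil, Ch. I §3, Lemma 4; §4) -/

/-- **Weil, Ch. I §3, Lemma 4**: if `mod_F` is bounded (by `1`) on the prime ring, then `mod_F` is
ultrametric. (Proof here: a power `mod_F ^ t` is an absolute value with `‖n‖ ≤ 1` for all `n : ℕ`,
hence ultrametric by Mathlib's `isUltrametricDist_of_forall_norm_natCast_le_one`.)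
[cite: WeilBNT1967, Ch. I §3, Lemma 4] -/
theorem modulus_add_le_max (h : ∀ n : ℕ, modulus F n ≤ 1) (x y : F) :
    modulus F (x + y) ≤ max (modulus F x) (modulus F y) := by
  obtain ⟨v, t, ht, hv⟩ := exists_absoluteValue_eq_modulus_rpow F
  have hn : ∀ n : ℕ, ‖(n : WithAbs v)‖ ≤ 1 := by
    intro n
    rw [← map_natCast (WithAbs.equiv v).symm n, WithAbs.equiv_symm_apply, WithAbs.norm_toAbs_eq,
      hv]
    exact Real.rpow_le_one (NNReal.coe_nonneg _) (by exact_mod_cast h n) ht.le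
  have hU : IsUltrametricDist (WithAbs v) :=
    IsUltrametricDist.isUltrametricDist_of_forall_norm_natCast_le_one hn
  have key := hU.norm_add_le_max (WithAbs.toAbs v x) (WithAbs.toAbs v y)
  rw [← WithAbs.toAbs_add, WithAbs.norm_toAbs_eq, WithAbs.norm_toAbs_eq, WithAbs.norm_toAbs_eq,
    hv, hv, hv, ← Real.rpow_max (NNReal.coe_nonneg _) (NNReal.coe_nonneg _) ht.le,
    Real.rpow_le_rpow_iff (NNReal.coe_nonneg _) (le_max_of_le_left (NNReal.coe_nonneg _)) ht]
    at key
  exact_mod_cast key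

/-- **The non-archimedean case** (Weil, Ch. I §3 Thm. 5 (a)/(b, `v = p`) with §4 Thm. 6): if
`mod_F (n · 1) ≤ 1` for all `n`, then `mod_F` is a valuation (Weil, Ch. I §4, Thm. 6: `R = {mod_F ≤ 1}`
is a ring with maximal ideal `P = {mod_F < 1}`) whose valuative relation makes `F` a
non-archimedean local field in Mathlib's sense (valuative topology = the given topology by Weil,
Ch. I §2, Cor. 1 of Prop. 2; non-trivial value group since `F` is not discrete; locally compact by
hypothesis). [cite: WeilBNT1967, Ch. I §4, Thm. 6] -/
theorem exists_isNonarchimedeanLocalField (h : ∀ n : ℕ, modulus F n ≤ 1) :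
    ∃ r : ValuativeRel F, @IsNonarchimedeanLocalField F _ r _ := by
  have hF : ¬ DiscreteTopology F := IsLocalField.not_discrete
  let v : Valuation F ℝ≥0 := { modulus F with map_add_le_max' := modulus_add_le_max h }
  have v_apply : ∀ x, v x = modulus F x := fun x => rfl
  letI r : ValuativeRel F := ValuativeRel.ofValuation v
  haveI hc : v.Compatible := Valuation.Compatible.ofValuation v
  refine ⟨r, ?_⟩
  haveI : IsValuativeTopology F := by
    refine IsValuativeTopology.of_zero fun s => ?_
    rw [(hasBasis_nhds_zero_modulus hF).mem_iff]
    constructor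
    · rintro ⟨ε, hε, hsub⟩
      obtain ⟨a, -, ha0, haε⟩ := exists_ne_zero_modulus_lt hF hε univ_mem
      have hva : ValuativeRel.valuation F a ≠ 0 := by simpa using ha0
      refine ⟨Units.mk0 _ hva, fun x hx => hsub ?_⟩
      have hx' : x <ᵥ a := (Valuation.vlt_iff_lt (ValuativeRel.valuation F)).mpr hx
      have : v x < v a := (Valuation.vlt_iff_lt v).mp hx'
      rw [v_apply, v_apply] at this
      exact this.trans haε
    · rintro ⟨γ, hγ⟩
      obtain ⟨a, ha⟩ := ValuativeRel.valuation_surjective (γ : ValuativeRel.ValueGroupWithZero F)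
      have ha0 : a ≠ 0 := by
        rintro rfl
        exact γ.ne_zero (by simpa using ha.symm)
      refine ⟨modulus F a, modulus_pos ha0, fun x hx => hγ ?_⟩
      have hx' : x <ᵥ a := (Valuation.vlt_iff_lt v).mpr (by rwa [v_apply, v_apply])
      show ValuativeRel.valuation F x < γ
      rw [← ha]
      exact (Valuation.vlt_iff_lt (ValuativeRel.valuation F)).mp hx'
  haveI : ValuativeRel.IsNontrivial F := by
    rw [ValuativeRel.isNontrivial_iff_isNontrivial v]
    obtain ⟨a, -, ha0, ha1⟩ := exists_ne_zero_modulus_lt hF one_pos univ_mem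
    exact ⟨a, by simpa [v_apply] using ha0, by rw [v_apply]; exact ne_of_lt ha1⟩
  exact {}

/-! ### The archimedean case (Weil, Ch. I §3, Thm. 5 (b), `v = ∞`) -/

/-- If `mod_F` is not bounded by `1` on the natural numbers then `F` has characteristic `0`
(Weil, Ch. I §3, proof of Thm. 5: on a finite prime field `mod_F` takes finitely many values, but
`mod_F (n ^ k) = mod_F n ^ k` would be unbounded). [cite: WeilBNT1967, Ch. I §3, Thm. 5] -/
theorem charZero_of_not_forall_modulus_natCast_le (h : ¬ ∀ n : ℕ, modulus F n ≤ 1) :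
    CharZero F := by
  rcases CharP.exists' F with hc | ⟨p, hp, hchar⟩
  · exact hc
  · exfalso
    apply h
    intro n
    classical
    set T : Finset ℝ≥0 := (Finset.range p).image fun k : ℕ => modulus F (k : F) with hT
    have hmem : ∀ m : ℕ, modulus F (m : F) ∈ T := by
      intro m
      refine Finset.mem_image.mpr ⟨m % p, Finset.mem_range.mpr (Nat.mod_lt _ hp.out.pos), ?_⟩
      rw [← CharP.cast_eq_mod F p m]
    by_contra! hn
    obtain ⟨m, hm⟩ := pow_unbounded_of_one_lt (T.sup id) hn
    have hle : modulus F ((n ^ m : ℕ) : F) ≤ T.sup id := Finset.le_sup (f := id) (hmem (n ^ m))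
    rw [Nat.cast_pow, map_pow] at hle
    exact absurd (hm.trans_le hle) (lt_irrefl _)

/-- In the unbounded case, some power `mod_F ^ s` (`s > 0`) induces the ordinary absolute value on
`ℚ ⊆ F` (Weil, Ch. I §3, Thm. 5 with Lemma 3: `F(m) = m ^ λ`; here via Ostrowski's theorem for `ℚ`,
Mathlib's `Rat.AbsoluteValue.equiv_real_of_unbounded`, applied to the absolute value `mod_F ^ t`).
[cite: WeilBNT1967, Ch. I §3, Thm. 5] -/
theorem exists_modulus_rpow_ratCast_eq_abs [CharZero F] (h : ¬ ∀ n : ℕ, modulus F n ≤ 1) :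
    ∃ s : ℝ, 0 < s ∧ ∀ q : ℚ, (modulus F (q : F) : ℝ) ^ s = |(q : ℝ)| := by
  obtain ⟨v, t, ht, hv⟩ := exists_absoluteValue_eq_modulus_rpow F
  set g : AbsoluteValue ℚ ℝ := v.comp (f := Rat.castHom F) (Rat.cast_injective) with hg
  have hg_apply : ∀ q : ℚ, g q = (modulus F (q : F) : ℝ) ^ t := fun q => hv q
  have hg' : ¬ ∀ n : ℕ, g n ≤ 1 := by
    intro hn
    apply h
    intro n
    have h1 := hn n
    rw [hg_apply, Rat.cast_natCast] at h1
    have h2 : (modulus F (n : F) : ℝ) ≤ 1 := by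
      by_contra! hlt
      have := Real.one_lt_rpow hlt ht
      exact absurd (h1.trans_lt this) (lt_irrefl _)
    exact_mod_cast h2
  obtain ⟨c, hc, hcg⟩ := AbsoluteValue.isEquiv_iff_exists_rpow_eq.mp
    (Rat.AbsoluteValue.equiv_real_of_unbounded hg')
  refine ⟨t * c, mul_pos ht hc, fun q => ?_⟩
  have hq := congrFun hcg q
  simp only [Rat.AbsoluteValue.real_eq_abs, Rat.cast_abs] at hq
  rw [Real.rpow_mul (NNReal.coe_nonneg _), ← hg_apply, hq]

/-- In the unbounded case, a power `N = mod_F ^ s` is an absolute value on `F` inducing the ordinary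
absolute value on `ℚ` (Weil, Ch. I §3, proof of Thm. 5: "`mod_K` induces `x ↦ |x| ^ λ` on `ℚ`";
the triangle inequality for `N` is Artin's criterion with `N n = n`).
[cite: WeilBNT1967, Ch. I §3, Thm. 5] -/
theorem exists_absoluteValue_ratCast_eq_abs [CharZero F] (h : ¬ ∀ n : ℕ, modulus F n ≤ 1) :
    ∃ (N : AbsoluteValue F ℝ) (s : ℝ), 0 < s ∧ (∀ x, N x = (modulus F x : ℝ) ^ s) ∧
      ∀ q : ℚ, N (q : F) = |(q : ℝ)| := by
  obtain ⟨s, hs, hsq⟩ := exists_modulus_rpow_ratCast_eq_abs h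
  obtain ⟨A, -, hA⟩ := exists_modulus_add_le_mul_max (F := F) IsLocalField.not_discrete
  set f := nnrealRPow (modulus F) hs with hf
  have hf0 : ∀ x, 0 ≤ f x := nnrealRPow_nonneg _ _
  have hfA := nnrealRPow_add_le (modulus F) hs hA
  have hfnat : ∀ m : ℕ, f m ≤ 1 * m := by
    intro m
    rw [one_mul, hf, nnrealRPow_apply]
    have := hsq m
    rw [Rat.cast_natCast, Rat.cast_natCast, Nat.abs_cast] at this
    exact this.le
  let N : AbsoluteValue F ℝ :=
    { toFun := f
      map_mul' := map_mul f
      nonneg' := hf0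
      eq_zero' := fun x =>
        ⟨fun hx => (map_eq_zero (modulus F)).mp ((nnrealRPow_eq_zero_iff _ _ x).mp hx),
          fun hx => by rw [hx, map_zero]⟩
      add_le' := map_add_le_add_of_map_natCast_le f hfA hf0 hfnat }
  exact ⟨N, s, hs, fun x => rfl, fun q => hsq q⟩

/-- **The archimedean case** (Weil, Ch. I §3, Thm. 5 (b) with `v = ∞`, and the remark after
Def. 2 that the commutative `ℝ`-fields are `ℝ` and `ℂ`): if `mod_F` is unbounded on the prime ring,
then `F` is isomorphic, as a topological field, to `ℝ` or to `ℂ`. The closure of `ℚ` is `ℝ`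
(extension of the isometry `ℚ → F` to the completion `ℝ` of `ℚ`), `F` is a normed `ℝ`-algebra for
`N = mod_F ^ s`, and the Gelfand–Mazur–Ostrowski theorem
(`NormedAlgebra.Real.nonempty_algEquiv_or`) applies. [cite: WeilBNT1967, Ch. I §3, Thm. 5] -/
theorem ringEquiv_real_or_complex [CharZero F] (h : ¬ ∀ n : ℕ, modulus F n ≤ 1) :
    (∃ e : F ≃+* ℝ, IsHomeomorph e) ∨ (∃ e : F ≃+* ℂ, IsHomeomorph e) := by
  obtain ⟨N, s, hs, hN, hNq⟩ := exists_absoluteValue_ratCast_eq_abs h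
  -- the topology of `F` is the `N`-topology, so `WithAbs N` is locally compact, hence complete
  have heF : IsHomeomorph (WithAbs.equiv N).symm :=
    (isHomeomorph_iff_exists_inverse).mpr ⟨continuous_withAbsEquiv_symm hs hN, WithAbs.equiv N,
      (WithAbs.equiv N).apply_symm_apply, (WithAbs.equiv N).symm_apply_apply,
      continuous_withAbsEquiv hs hN⟩
  haveI : LocallyCompactSpace (WithAbs N) := locallyCompactSpace_withAbs hs hN
  have hN2 : ‖WithAbs.toAbs N (2 : F)‖ = 2 := by
    rw [WithAbs.norm_toAbs_eq]
    have := hNq 2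
    rw [Rat.cast_ofNat, Rat.cast_ofNat] at this
    rw [this]
    norm_num
  letI : NontriviallyNormedField (WithAbs N) := NontriviallyNormedField.ofNormNeOne
    ⟨WithAbs.toAbs N 2, fun h0 => by simp [h0] at hN2, by rw [hN2]; norm_num⟩
  haveI : ProperSpace (WithAbs N) := ProperSpace.of_locallyCompactSpace (WithAbs N)
  -- `ℚ → WithAbs N` is an isometric ring homomorphism
  let φ₀ : ℚ →+* WithAbs N := (WithAbs.equiv N).symm.toRingHom.comp (Rat.castHom F)
  have hφ₀ : ∀ q : ℚ, φ₀ q = WithAbs.toAbs N (q : F) := fun q => rfl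
  have hφ₀_norm : ∀ q : ℚ, ‖φ₀ q‖ = ‖q‖ := by
    intro q
    rw [hφ₀, WithAbs.norm_toAbs_eq, hNq, ← Rat.norm_cast_real, Real.norm_eq_abs]
  have hφ₀_iso : Isometry φ₀ := AddMonoidHomClass.isometry_of_norm φ₀ hφ₀_norm
  -- extend it by uniform continuity to `ψ : ℝ → WithAbs N` (`ℝ` is the completion of `ℚ`)
  have he : IsUniformInducing ((↑) : ℚ → ℝ) := Rat.isUniformEmbedding_coe_real.isUniformInducing
  have hdense : DenseRange ((↑) : ℚ → ℝ) := Rat.isDenseEmbedding_coe_real.dense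
  let ψ : ℝ → WithAbs N := (he.isDenseInducing hdense).extend φ₀
  have hψc : Continuous ψ :=
    (uniformContinuous_uniformly_extend he hdense hφ₀_iso.uniformContinuous).continuous
  have hψq : ∀ q : ℚ, ψ q = φ₀ q := fun q =>
    uniformly_extend_of_ind he hdense hφ₀_iso.uniformContinuous q
  have hψ1 : ψ 1 = 1 := by rw [show (1 : ℝ) = ((1 : ℚ) : ℝ) by norm_num, hψq, map_one]
  have hψ0 : ψ 0 = 0 := by rw [show (0 : ℝ) = ((0 : ℚ) : ℝ) by norm_num, hψq, map_zero]
  have hψmul : ∀ a b : ℝ, ψ (a * b) = ψ a * ψ b := fun a b =>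
    hdense.induction_on₂ (p := fun a b => ψ (a * b) = ψ a * ψ b)
      (isClosed_eq (hψc.comp continuous_mul)
        ((hψc.comp continuous_fst).mul (hψc.comp continuous_snd)))
      (fun p q => by simp only [← Rat.cast_mul, hψq, map_mul]) a b
  have hψadd : ∀ a b : ℝ, ψ (a + b) = ψ a + ψ b := fun a b =>
    hdense.induction_on₂ (p := fun a b => ψ (a + b) = ψ a + ψ b)
      (isClosed_eq (hψc.comp continuous_add)
        ((hψc.comp continuous_fst).add (hψc.comp continuous_snd)))
      (fun p q => by simp only [← Rat.cast_add, hψq, map_add]) a b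
  let ψhom : ℝ →+* WithAbs N :=
    { toFun := ψ, map_one' := hψ1, map_mul' := hψmul, map_zero' := hψ0, map_add' := hψadd }
  have hψnorm : ∀ r : ℝ, ‖ψhom r‖ = ‖r‖ := fun r =>
    hdense.induction_on (p := fun r : ℝ => ‖ψ r‖ = ‖r‖) r
      (isClosed_eq (continuous_norm.comp hψc) continuous_norm)
      (fun q => by
        show ‖ψ q‖ = ‖(q : ℝ)‖
        rw [hψq, hφ₀_norm, Rat.norm_cast_real])
  -- `WithAbs N` is a normed `ℝ`-algebra (a field), hence `≃ₐ[ℝ] ℝ` or `≃ₐ[ℝ] ℂ`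
  letI : Algebra ℝ (WithAbs N) := ψhom.toAlgebra
  letI : NormedAlgebra ℝ (WithAbs N) :=
    ⟨fun r x => by rw [Algebra.smul_def, norm_mul, RingHom.algebraMap_toAlgebra, hψnorm]⟩
  -- the homeomorphism `F ≃ₜ WithAbs N`
  let eF : F ≃ₜ WithAbs N :=
    { toEquiv := (WithAbs.equiv N).symm.toEquiv
      continuous_toFun := continuous_withAbsEquiv_symm hs hN
      continuous_invFun := continuous_withAbsEquiv hs hN }
  rcases NormedAlgebra.Real.nonempty_algEquiv_or (WithAbs N) with ⟨⟨e₁⟩⟩ | ⟨⟨e₁⟩⟩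
  · left
    haveI : FiniteDimensional ℝ (WithAbs N) := e₁.symm.toLinearEquiv.finiteDimensional
    let e₂ : WithAbs N ≃L[ℝ] ℝ := e₁.toLinearEquiv.toContinuousLinearEquiv
    refine ⟨(WithAbs.equiv N).symm.trans e₁.toRingEquiv, ?_⟩
    exact (eF.trans e₂.toHomeomorph).isHomeomorph
  · right
    haveI : FiniteDimensional ℝ (WithAbs N) := e₁.symm.toLinearEquiv.finiteDimensional
    let e₂ : WithAbs N ≃L[ℝ] ℂ := e₁.toLinearEquiv.toContinuousLinearEquiv
    refine ⟨(WithAbs.equiv N).symm.trans e₁.toRingEquiv, ?_⟩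
    exact (eF.trans e₂.toHomeomorph).isHomeomorph

/-! ### Weil's classification -/

/-- **Weil's classification of local fields** (*Basic Number Theory*, 1967, Ch. I §3 Theorem 5 and
§4 Theorem 8): every local field in Weil's sense is either a non-archimedean local field (for the
valuative relation of its module `mod_F`) or isomorphic as a topological field to `ℝ` or to `ℂ`.
Discharges the named fact `Literature.NumberTheory.GaloisRepresentations.IsLocalField.isNonarchimedean_or_archimedean`.
[cite: WeilBNT1967, Ch. I §3 Theorem 5 and §4 Theorem 8] -/
theorem isNonarchimedean_or_archimedean_holds : isNonarchimedean_or_archimedean := by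
  intro F _ _ _
  by_cases h : ∀ n : ℕ, modulus F n ≤ 1
  · exact Or.inl (exists_isNonarchimedeanLocalField h)
  · haveI := charZero_of_not_forall_modulus_natCast_le h
    exact Or.inr (ringEquiv_real_or_complex h)

/-- Weil's classification under the outline's second name
(`Literature.NumberTheory.GaloisRepresentations.IsLocalField.nonarchimedean_or_archimedean`, an alias of
`isNonarchimedean_or_archimedean`). [cite: WeilBNT1967, Ch. I §3 Theorem 5 and §4 Theorem 8] -/
theorem nonarchimedean_or_archimedean_holds : nonarchimedean_or_archimedean :=
  isNonarchimedean_or_archimedean_holds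

end IsLocalField

end Literature.NumberTheory.GaloisRepresentations

/-! ### `|ϖ|_F = q_F⁻¹`: discharge of the named fact `normAbs_uniformizer`

Cassels–Fröhlich (1967), Ch. II (Cassels, *Global fields*) §7, Definition: a discrete valuation with
finite residue field of `P` elements is *normalised* when `|π| = P⁻¹` for `𝔭 = (π)`; Tate,
*Number theoretic background* (Corvallis 1979), (1.4.1) uses this normalised `|x|_F` for a
non-archimedean local field `F` (`|ϖ|_F = q⁻¹`, `q` the residue cardinality). With `normAbs`
built from Mathlib's order isomorphism `valueGroupWithZeroIsoInt F : ValueGroupWithZero F ≃*o ℤᵐ⁰`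
and `WithZeroMulInt.toNNReal` (base `q_F`), the proof is: the valuation `F → ValueGroupWithZero F`
is surjective, so its value group is all of `(ValueGroupWithZero F)ˣ`; the generator `< 1` of that
(infinite cyclic) group is carried by the order isomorphism to a generator `< 1` of `(ℤᵐ⁰)ˣ`,
which can only be `exp (-1)`; and `toNNReal (exp (-1)) = q_F⁻¹`. -/

namespace Literature.NumberTheory.GaloisRepresentations.IsNonarchimedeanLocalField

open scoped WithZero
open ValuativeRel

variable {F : Type*} [Field F] [ValuativeRel F] [TopologicalSpace F] [IsNonarchimedeanLocalField F]

omit [TopologicalSpace F] [IsNonarchimedeanLocalField F] in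
/-- The value group of the canonical valuation `F → ValueGroupWithZero F` of a field with a
valuative relation is all of `(ValueGroupWithZero F)ˣ`, because that valuation is surjective.
[folklore] -/
theorem valueGroup_valuation_eq_top :
    MonoidWithZeroHom.valueGroup (MonoidWithZeroHom.ofClass (valuation F)) = ⊤ := by
  refine top_unique fun u _ ↦ MonoidWithZeroHom.mem_valueGroup _ ?_
  obtain ⟨x, hx⟩ := ValuativeRel.valuation_surjective (u : ValueGroupWithZero F)
  exact ⟨x, hx⟩

/-- The order isomorphism `valueGroupWithZeroIsoInt F : ValueGroupWithZero F ≃*o ℤᵐ⁰` sends the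
generator `< 1` of the value group of `valuation F` (i.e. the valuation of any uniformizer) to
`exp (-1)`: a generator `< 1` of the infinite cyclic ordered group `(ℤᵐ⁰)ˣ` is `exp (-1)`.
[folklore] -/
theorem valueGroupWithZeroIsoInt_generator :
    _root_.IsNonarchimedeanLocalField.valueGroupWithZeroIsoInt F
        (Valuation.IsRankOneDiscrete.generator (valuation F) : ValueGroupWithZero F) =
      WithZero.exp (-1 : ℤ) := by
  set e := _root_.IsNonarchimedeanLocalField.valueGroupWithZeroIsoInt F with he_def
  set g := Valuation.IsRankOneDiscrete.generator (valuation F) with hg_def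
  -- the generator transported to `(ℤᵐ⁰)ˣ`
  set u : (ℤᵐ⁰)ˣ := Units.mapEquiv e.toMulEquiv g with hu_def
  have hu : (u : ℤᵐ⁰) = e g := Units.coe_mapEquiv _ _
  -- it generates all of `(ℤᵐ⁰)ˣ`
  have hzp : Subgroup.zpowers u = ⊤ := by
    rw [hu_def, ← MulEquiv.coe_toMonoidHom, ← MonoidHom.map_zpowers,
      Valuation.IsRankOneDiscrete.generator_zpowers_eq_valueGroup, valueGroup_valuation_eq_top]
    exact Subgroup.map_top_of_surjective _ (Units.mapEquiv e.toMulEquiv).surjective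
  -- and it is `< 1`
  have hg1 : (g : ValueGroupWithZero F) < 1 := by
    have h := Valuation.IsRankOneDiscrete.generator_lt_one (valuation F)
    rwa [← Units.val_lt_val, Units.val_one] at h
  have hlt : e g < 1 := by
    have h := (map_lt_map_iff e).2 hg1
    rwa [map_one] at h
  -- `exp (-1)` is a power of it
  obtain ⟨k, hk⟩ : ∃ k : ℤ, u ^ k = Units.mk0 (WithZero.exp (-1 : ℤ)) WithZero.exp_ne_zero := by
    rw [← Subgroup.mem_zpowers_iff, hzp]
    exact Subgroup.mem_top _
  have hk' : (e g) ^ k = WithZero.exp (-1 : ℤ) := by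
    have h := congrArg Units.val hk
    rwa [Units.val_zpow_eq_zpow_val, Units.val_mk0, hu] at h
  -- write `e g = exp n`; then `k * n = -1` and `n < 0`, so `n = -1`
  have hne : e g ≠ 0 := hu ▸ u.ne_zero
  have hegn : e g = WithZero.exp (WithZero.log (e g)) := (WithZero.exp_log hne).symm
  rw [hegn, ← WithZero.exp_zsmul, WithZero.exp_inj, smul_eq_mul] at hk'
  rw [hegn, ← WithZero.exp_zero, WithZero.exp_lt_exp] at hlt
  change e g = WithZero.exp (-1 : ℤ)
  rcases Int.eq_one_or_neg_one_of_mul_eq_neg_one' hk' with ⟨-, h⟩ | ⟨-, h⟩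
  · rw [hegn, h]
  · exact absurd hlt (by rw [h]; decide)

/-- **`|ϖ|_F = q_F⁻¹`** for a uniformizer `ϖ` of a non-archimedean local field `F`: discharge of
the named fact `normAbs_uniformizer`. This is the defining property of the *normalised* valuation
of a discretely valued field with finite residue field of `P = q_F` elements, `|π| = P⁻¹` for
`𝔭 = (π)` (Cassels, *Global fields*, in Cassels–Fröhlich 1967, Ch. II §7, Definition; Tate,
*Number theoretic background*, Corvallis 1979, (1.4.1), `|ϖ|_F = q⁻¹`).
[cite: CasselsFrohlichANT1967, Ch. II §7, Definition] [cite: TateCorvallis1979, (1.4.1)] -/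
theorem normAbs_uniformizer_holds : normAbs_uniformizer (F := F) := by
  intro ϖ hϖ
  rw [normAbs_apply, hϖ.val, valueGroupWithZeroIsoInt_generator, WithZero.exp,
    WithZeroMulInt.toNNReal_neg_apply _ WithZero.coe_ne_zero, WithZero.unzero_coe, toAdd_ofAdd,
    zpow_neg, zpow_one]

end Literature.NumberTheory.GaloisRepresentations.IsNonarchimedeanLocalField
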